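import Literature.NumberTheory.GaloisRepresentations.GaloisRep
import Literature.NumberTheory.GaloisRepresentations.ContinuousRep
import Literature.NumberTheory.GaloisRepresentations.FrobeniusDensity
import Literature.RepresentationTheory.Semisimple.EquivOfCharacter
import HarnessLib

/-!
# Semisimple Galois representations are determined by Frobenius characteristic polynomials

Topic `Literature/NumberTheory/GaloisRepresentations`.  **Proved** (modulo the tree's named
fact `Literature.NumberTheory.Automorphic.chebotarev_artinRep`, Chebotarev's density theorem in existence form for Artin
representations, through the density of Frobenius elements of `FrobeniusDensity`): two
continuous *semisimple* representations
`r, r' : Γ_K → GL_n(A)` of the absolute Galois group of a number field `K` over a Hausdorff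
topological field `A` of characteristic `0` (`ℚ̄_ℓ = PadicAlgCl ℓ`, a finite extension `E_λ`
of `ℚ_ℓ`, `ℂ`, …) which, at all but finitely many finite places `v`, are unramified with a
common characteristic polynomial of the arithmetic Frobenius
(`FramedGaloisRep.HasFrobCharpolyAt`, trunk GalRep) are isomorphic (`ContinuousRep.Equiv`).
This is the classical "Chebotarev + Brauer–Nesbitt" uniqueness statement (Deligne–Serre,
*Formes modulaires de poids 1* (1974), Lemme 3.2, p. 513, for `G_ℚ`: "Cela résulte du
théorème de densité de Čebotarev, combiné avec le fait qu'une représentation linéaire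
semi-simple d'un groupe est déterminée, à isomorphisme près, par les polynômes
caractéristiques (resp. les traces …)"; Serre, *Abelian `ℓ`-adic representations*,
Ch. I §2, for number fields), used with `A = ℚ̄_ℓ` for the uniqueness clause of
Harris–Lan–Taylor–Thorne's Thm. A
(`Literature.NumberTheory.Automorphic.ReciprocityGLnProofs`, `theoremA_uniqueness_of`).  The
tree's `Literature.NumberTheory.GaloisRepresentations.DeligneSerre1974.lemma32_complex` (`ArtinRepFrobenius`; `K = ℚ`, `A = ℂ`, finite
image) is the printed Lemme 3.2 itself, proved in `ArtinRepFrobeniusProofs` from the `ℚ`-form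
`Literature.NumberTheory.LFunctions.Chebotarev.dirichletDensity_eq` of Chebotarev and the finite-group character theory along
the same lines; the present statement allows any number field and infinite image, whence the
semisimplicity hypotheses.

Proof (`FramedGaloisRep.nonempty_equiv_of_hasFrobCharpolyAt_eventually`): at an arithmetic
Frobenius `σ` over a good place both characteristic polynomials equal the common `P`, so the
traces agree (`Matrix.trace_eq_neg_charpoly_coeff`); the set `{tr r = tr r'}` is closed
(`FramedRep.continuous_trace`, `A` Hausdorff) and contains the dense set of such Frobenii
(`absoluteGaloisGroup.frobenius_dense`), hence is everything; so the characters of the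
underlying representations on `Aⁿ` agree (`character_toRepresentation`) and Brauer–Nesbitt
in characteristic `0` for semisimple representations of the (infinite) group `Γ_K`
(`Literature.RepresentationTheory.Semisimple.Representation.nonempty_equiv_of_character_eq_of_isSemisimple`, Bourbaki A VIII § 20
n° 6) gives an equivalence, automatically bicontinuous on `Fin n → A`
(`LinearMap.continuous_on_pi`).

## References

* P. Deligne, J.-P. Serre, *Formes modulaires de poids 1*, Ann. Sci. ÉNS 7 (1974), Lemme 3.2
  (p. 513). [DeligneSerreASENS1974]
* J.-P. Serre, *Abelian ℓ-adic representations and elliptic curves* (1968), Ch. I §2.2–2.3.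
  [SerreAbelianLadic1968]
* N. Bourbaki, *Algèbre* VIII (2012), § 20 n° 6, Cor. a) de la Prop. 6. [BourbakiAlgebreVIII2012]
-/

noncomputable section

open scoped NumberField
open IsDedekindDomain Field

namespace Literature.NumberTheory.GaloisRepresentations

section LAdic

variable {K : Type} [Field K] [NumberField K] {A : Type*} [Field A] [TopologicalSpace A]
  [IsTopologicalRing A] {n : ℕ}

omit [NumberField K] in
/-- The character of the representation on `Aⁿ` underlying a framed Galois representation
is its matrix trace (Mathlib `Matrix.trace_toLin'_eq`). [folklore] -/
theorem FramedGaloisRep.character_toRepresentation (r : FramedGaloisRep K A n)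
    (σ : absoluteGaloisGroup K) :
    r.toGaloisRep.toRepresentation.character σ = FramedRep.trace r σ := by
  change LinearMap.trace _ _ (r.toRepresentation σ) = _
  have : r.toRepresentation σ =
      Matrix.toLin' ((r σ : GL (Fin n) A) : Matrix (Fin n) (Fin n) A) := by
    apply LinearMap.ext
    intro v
    rw [FramedRep.toRepresentation_apply_apply, Matrix.toLin'_apply]
  rw [this, Matrix.trace_toLin'_eq]
  rfl

/-- **Semisimple Galois representations with the same Frobenius characteristic polynomials
at almost all places are isomorphic** (Deligne–Serre 1974, Lemme 3.2 — "Chebotarev +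
Brauer–Nesbitt" — in the number-field setting, coefficients in any Hausdorff topological field
`A` of characteristic `0`).  For a number field `K` and continuous semisimple
`r, r' : Γ_K → GL_n(A)` such that for all but finitely many finite places `v` both are
unramified at `v` and have a common characteristic polynomial of arithmetic Frobenius at `v`,
there is an isomorphism of the underlying continuous representations.  Proved from the named
fact `Lang.chebotarev_artinRep` (Chebotarev, hypothesis `hC`); see the module docstring.
[cite: DeligneSerreASENS1974, Lemme 3.2 (p. 513)] -/
theorem FramedGaloisRep.nonempty_equiv_of_hasFrobCharpolyAt_eventually [T2Space A] [CharZero A]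
    (hC : Automorphic.chebotarev_artinRep)
    (r r' : FramedGaloisRep K A n)
    (hr : r.toGaloisRep.IsSemisimple) (hr' : r'.toGaloisRep.IsSemisimple)
    (h : ∀ᶠ v : HeightOneSpectrum (𝓞 K) in Filter.cofinite,
      r.IsUnramifiedAt v ∧ r'.IsUnramifiedAt v ∧
        ∃ P : Polynomial A, r.HasFrobCharpolyAt v P ∧ r'.HasFrobCharpolyAt v P) :
    Nonempty (ContinuousRep.Equiv r.toGaloisRep r'.toGaloisRep) := by
  classical
  set S : Set (HeightOneSpectrum (𝓞 K)) := {v | ¬ (r.IsUnramifiedAt v ∧ r'.IsUnramifiedAt v ∧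
      ∃ P : Polynomial A, r.HasFrobCharpolyAt v P ∧ r'.HasFrobCharpolyAt v P)}
    with hSdef
  have hS : S.Finite := Filter.eventually_cofinite.1 h
  set D : Set (absoluteGaloisGroup K) :=
    {σ | ∃ v ∉ S, ∃ 𝔓 ∈ v.primesAbove, IsArithFrobAt (𝓞 K) σ 𝔓} with hDdef
  -- traces agree on the Frobenius elements over good places
  have hF : D ⊆ {σ | FramedRep.trace r σ = FramedRep.trace r' σ} := by
    rintro σ ⟨v, hv, 𝔓, h𝔓, hσ⟩
    simp only [hSdef, Set.mem_setOf_eq, not_not] at hv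
    obtain ⟨-, -, P, hP, hP'⟩ := hv
    have h1 : FramedRep.charpoly r σ = P := hP 𝔓 h𝔓 σ hσ
    have h2 : FramedRep.charpoly r' σ = P := hP' 𝔓 h𝔓 σ hσ
    show FramedRep.trace r σ = FramedRep.trace r' σ
    rcases Nat.eq_zero_or_pos n with hn | hn
    · subst hn
      simp [FramedRep.trace, Matrix.trace]
    · haveI : Nonempty (Fin n) := ⟨⟨0, hn⟩⟩
      unfold FramedRep.trace
      rw [Matrix.trace_eq_neg_charpoly_coeff, Matrix.trace_eq_neg_charpoly_coeff]
      change -((FramedRep.charpoly r σ).coeff _) = -((FramedRep.charpoly r' σ).coeff _)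
      rw [h1, h2]
  -- the coincidence set is closed and contains a dense set
  have hclosed :
      IsClosed {σ : absoluteGaloisGroup K | FramedRep.trace r σ = FramedRep.trace r' σ} :=
    isClosed_eq (FramedRep.continuous_trace r) (FramedRep.continuous_trace r')
  have hall : ∀ σ, FramedRep.trace r σ = FramedRep.trace r' σ := by
    intro σ
    have hmem : σ ∈ closure D := by
      rw [(absoluteGaloisGroup.frobenius_dense hC K S hS).closure_eq]
      exact Set.mem_univ σ
    exact hclosed.closure_subset_iff.2 hF hmem
  -- equal characters, then Brauer–Nesbitt and automatic continuity
  have hchar : r.toGaloisRep.toRepresentation.character =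
      r'.toGaloisRep.toRepresentation.character := by
    funext σ
    rw [FramedGaloisRep.character_toRepresentation, FramedGaloisRep.character_toRepresentation,
      hall σ]
  haveI : r.toGaloisRep.toRepresentation.IsSemisimpleRepresentation := hr
  haveI : r'.toGaloisRep.toRepresentation.IsSemisimpleRepresentation := hr'
  obtain ⟨e⟩ := Literature.RepresentationTheory.Semisimple.Representation.nonempty_equiv_of_character_eq_of_isSemisimple _ _ hchar
  exact ⟨⟨e, LinearMap.continuous_on_pi e.toLinearEquiv.toLinearMap,
    LinearMap.continuous_on_pi e.toLinearEquiv.symm.toLinearMap⟩⟩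

/-- Finite-exceptional-set form of `nonempty_equiv_of_hasFrobCharpolyAt_eventually`. [folklore] -/
theorem FramedGaloisRep.nonempty_equiv_of_hasFrobCharpolyAt_of_finite [T2Space A] [CharZero A]
    (hC : Automorphic.chebotarev_artinRep) {S : Set (HeightOneSpectrum (𝓞 K))} (hS : S.Finite)
    (r r' : FramedGaloisRep K A n)
    (hr : r.toGaloisRep.IsSemisimple) (hr' : r'.toGaloisRep.IsSemisimple)
    (hST : ∀ v ∉ S, r.IsUnramifiedAt v ∧ r'.IsUnramifiedAt v ∧
      ∃ P : Polynomial A, r.HasFrobCharpolyAt v P ∧ r'.HasFrobCharpolyAt v P) :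
    Nonempty (ContinuousRep.Equiv r.toGaloisRep r'.toGaloisRep) :=
  FramedGaloisRep.nonempty_equiv_of_hasFrobCharpolyAt_eventually hC r r' hr hr'
    (Filter.mem_of_superset hS.compl_mem_cofinite fun v hv ↦ hST v hv)

end LAdic

end Literature.NumberTheory.GaloisRepresentations
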